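import Literature.Barriers.CriticalPhenomena.LaceExpansionIsingAboveFourNNBubbleBound
import HarnessLib

/-!
# Discharge of `NNIsing.IsingBubbleMeanField` (bubble condition ⇒ `γ = 1`, nearest-neighbour
# Ising model on `ℤ^d`, `d ≥ 2`)

Barrier catalogue `Literature/Barriers/CriticalPhenomena/` (D-0021). The named fact
`Literature.Barriers.CriticalPhenomena.NNIsing.IsingBubbleMeanField` of
`LaceExpansionIsingAboveFour.lean` — Sakai 2007, §1.1: "the finiteness of `Σ_{x∈ℤ^d} G_{p_c}(x)²`
… implies that `β = 1/2`, `γ = 1` and `δ = 3` [a82, abf87, af86, ag83]", exponent `γ`, for the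
nearest-neighbour model: `∀ d, 2 ≤ d → BubbleCondition d → HasGammaOne d` — is now a THEOREM of
the tree, assembled here from

* `NNIsing.IsingBubbleMeanField_of_bubble_susceptibility_upper`
  (`LaceExpansionIsingAboveFourReduction.lean`): the lower half `χ(β) ≥ (4d)⁻¹(β_c - β)⁻¹`
  (`γ ≥ 1`, Lebowitz' inequality integrated; `SusceptibilityMeanFieldBound.lean`) and `0 < β_c`
  (Peierls) are tree theorems, leaving the upper half as the named fact
  `NNIsing.bubble_susceptibility_upper`;
* `NNIsing.bubble_susceptibility_upper_holds` (`LaceExpansionIsingAboveFourNNBubbleBound.lean`):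
  that upper half, `B(β_c) < ∞ ⇒ χ(β) ≤ C(β_c - β)⁻¹` near `β_c` (Aizenman 1982, Prop. 7.1;
  Aizenman–Graham 1983; Tasaki–Hara 2015, Thm. 10.13, (10.63)–(10.69)), proved from the
  random-current proof `aizenmanGraham_inequality_holds` of the Aizenman–Graham inequality
  (`AizenmanGrahamInequalityProofs.lean`; Tasaki–Hara 2015, Thm. A.18 (A.125)).

Nothing else is declared here.

## References

* A. Sakai, Comm. Math. Phys. 272 (2007) 283–344 (arXiv:math-ph/0510093), §1.1 [Sakai2007].
* M. Aizenman, Comm. Math. Phys. 86 (1982) 1–48, §7, Prop. 7.1 (read at Project Euclid,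
  cmp/1103921614, p. 17) [Aizenman1982].
* M. Aizenman, R. Graham, Nucl. Phys. B 225 (1983) 261–288 [AizenmanGraham1983].
* H. Tasaki, T. Hara, 相転移と臨界現象の数理 (Kyoritsu 2015), Thm. 10.13, Thm. A.18 [TasakiHara2015].
-/

noncomputable section

namespace Literature.Barriers.CriticalPhenomena.NNIsing

/-- **`NNIsing.IsingBubbleMeanField` holds**: for the nearest-neighbour Ising model on `ℤ^d`,
`d ≥ 2`, the bubble condition `Σ_x ⟨σ₀σ_x⟩²_{β_c} < ∞` implies the mean-field divergence of the
susceptibility, `c(β_c - β)⁻¹ ≤ χ(β) ≤ C(β_c - β)⁻¹` near `β_c` (`γ = 1`) — Sakai 2007, §1.1,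
quoting Aizenman 1982 (Prop. 7.1) / Aizenman–Graham 1983; proved along Tasaki–Hara 2015,
Thm. 10.13 with Thm. A.18. [cite: Sakai2007, §1.1 (bubble condition ⇒ γ = 1)]
[cite: Aizenman1982, Proposition 7.1] [cite: TasakiHara2015, Ch. 10, Thm. 10.13 with App. A, Thm. A.18] -/
theorem IsingBubbleMeanField_holds : IsingBubbleMeanField :=
  IsingBubbleMeanField_of_bubble_susceptibility_upper bubble_susceptibility_upper_holds

end Literature.Barriers.CriticalPhenomena.NNIsing

end
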